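import Literature.GroupTheory.CombinatorialGroupTheory.RandomSclFreeGroupCombCount
import HarnessLib

/-!
# Random rigidity of scl (Calegari–Walker 2013): proofs, part 26 — counting words with SOME comb
configuration (CW Lemma 4.14, the union bound)

D. Calegari, A. Walker, *Random rigidity in the free group*, Geom. Topol. 17 (2013)
[CalegariWalker2013], §4.6–4.7. Summing the per-configuration bound `card_filter_combConfig_le`
over all comb configurations of complexity `d` with sides and flanks `≤ ℓmax` and total length
`≥ Emin`, grouped by their set of pinned blocks (`sum_pow_card_pinned_le`):
`#{w ∈ F_n : w carries a g-regular comb configuration} ≤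
  2k(2k−1)^{n−1} · (2k−1)^{−Emin} · (ℓmax+1)^{2d+3} · Σ_S X^{|S|} (n+1)^{d+2−|S|} ((d+2)·Lblk)^{|S|}`,
`X = (2k−1)^{(2ℓmax+g)/2}`, `Lblk = (d+3)(ℓmax+1)`.

* **`combPred_congr`** — the comb predicate only depends on the data in range.
* **`card_filter_exists_combConfig_le`** — the union bound.
-/

noncomputable section

namespace Literature.GroupTheory.CombinatorialGroupTheory

section CombCountSum

open Finset

open scoped Classical

/-- **The comb predicate depends only on the data in range.** [folklore] -/
theorem combPred_congr {A : Type*} (inv : A → A) {n d ℓmax g Emin : ℕ} (s : ℕ)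
    (t lam kap t' lam' kap' : ℕ → ℕ) (vg : ℕ → A)
    (het : ∀ i, i < d + 1 → t' i = t i) (hel : ∀ i, i < d + 1 → lam' i = lam i)
    (hek : ∀ e, e < d + 2 → kap' e = kap e)
    (h : ((∀ i, i < d + 1 → lam i ≤ ℓmax) ∧ (∀ e, e < d + 2 → kap e ≤ ℓmax) ∧ kap 0 = 0 ∧
        kap (d + 1) = 0 ∧ s + ∑ i ∈ Finset.range (d + 1), lam i ≤ n ∧
        (∀ i, i < d + 1 → kap (i + 1) ≤ t i ∧ t i + lam i + kap i ≤ n) ∧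
        Emin ≤ (∑ i ∈ Finset.range (d + 1), lam i) + ∑ e ∈ Finset.range (d + 2), kap e) ∧
      (∀ i, i < d + 1 → ∀ j, j < lam i →
        vg (t i + j) = inv (vg (s + (∑ i' ∈ Finset.range i, lam i') + (lam i - 1 - j)))) ∧
      (∀ e, 1 ≤ e → e ≤ d → ∀ j, j < kap e →
        vg (t e + lam e + j) = inv (vg (t (e - 1) - 1 - j))) ∧
      (∀ x y, x ≠ y → x + g ≤ ∑ i' ∈ Finset.range (d + 1), lam i' →
        y + g ≤ ∑ i' ∈ Finset.range (d + 1), lam i' →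
          ∃ q, q < g ∧ vg (s + x + q) ≠ vg (s + y + q)) ∧
      (∀ x y, x + g ≤ ∑ i' ∈ Finset.range (d + 1), lam i' →
        y + g ≤ ∑ i' ∈ Finset.range (d + 1), lam i' →
          ∃ q, q < g ∧ vg (s + x + q) ≠ inv (vg (s + y + (g - 1 - q))))) :
    ((∀ i, i < d + 1 → lam' i ≤ ℓmax) ∧ (∀ e, e < d + 2 → kap' e ≤ ℓmax) ∧ kap' 0 = 0 ∧
        kap' (d + 1) = 0 ∧ s + ∑ i ∈ Finset.range (d + 1), lam' i ≤ n ∧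
        (∀ i, i < d + 1 → kap' (i + 1) ≤ t' i ∧ t' i + lam' i + kap' i ≤ n) ∧
        Emin ≤ (∑ i ∈ Finset.range (d + 1), lam' i) + ∑ e ∈ Finset.range (d + 2), kap' e) ∧
      (∀ i, i < d + 1 → ∀ j, j < lam' i →
        vg (t' i + j) = inv (vg (s + (∑ i' ∈ Finset.range i, lam' i') + (lam' i - 1 - j)))) ∧
      (∀ e, 1 ≤ e → e ≤ d → ∀ j, j < kap' e →
        vg (t' e + lam' e + j) = inv (vg (t' (e - 1) - 1 - j))) ∧
      (∀ x y, x ≠ y → x + g ≤ ∑ i' ∈ Finset.range (d + 1), lam' i' →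
        y + g ≤ ∑ i' ∈ Finset.range (d + 1), lam' i' →
          ∃ q, q < g ∧ vg (s + x + q) ≠ vg (s + y + q)) ∧
      (∀ x y, x + g ≤ ∑ i' ∈ Finset.range (d + 1), lam' i' →
        y + g ≤ ∑ i' ∈ Finset.range (d + 1), lam' i' →
          ∃ q, q < g ∧ vg (s + x + q) ≠ inv (vg (s + y + (g - 1 - q)))) := by
  obtain ⟨⟨hlam, hkap, hk0, hkl, hs, ht, hE⟩, hD, hF, hreg1, hreg2⟩ := h
  -- the sums agree
  have hsum : ∀ i, i ≤ d + 1 → ∑ i' ∈ Finset.range i, lam' i' = ∑ i' ∈ Finset.range i, lam i' := by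
    intro i hi
    apply Finset.sum_congr rfl
    intro i' hi'
    rw [Finset.mem_range] at hi'
    exact hel i' (by omega)
  have hsumK : ∑ e ∈ Finset.range (d + 2), kap' e = ∑ e ∈ Finset.range (d + 2), kap e := by
    apply Finset.sum_congr rfl
    intro e he
    rw [Finset.mem_range] at he
    exact hek e he
  have hL := hsum (d + 1) le_rfl
  refine ⟨⟨?_, ?_, ?_, ?_, ?_, ?_, ?_⟩, ?_, ?_, ?_, ?_⟩
  · intro i hi; rw [hel i hi]; exact hlam i hi
  · intro e he; rw [hek e he]; exact hkap e he
  · rw [hek 0 (by omega)]; exact hk0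
  · rw [hek (d + 1) (by omega)]; exact hkl
  · rw [hL]; exact hs
  · intro i hi
    rw [hek (i + 1) (by omega), het i hi, hel i hi, hek i (by omega)]
    exact ht i hi
  · rw [hL, hsumK]; exact hE
  · intro i hi j hj
    rw [hel i hi] at hj
    rw [het i hi, hsum i (by omega), hel i hi]
    exact hD i hi j hj
  · intro e he1 hed j hj
    rw [hek e (by omega)] at hj
    rw [het e (by omega), hel e (by omega), het (e - 1) (by omega)]
    exact hF e he1 hed j hj
  · rw [hL]; exact hreg1
  · rw [hL]; exact hreg2

set_option maxHeartbeats 1600000 in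
/-- **Words carrying some `g`-regular comb configuration are rare (CW Lemma 4.14, union bound).**
For `k, n, g ≥ 1`, complexity `d`, bound `ℓmax` on sides and flanks and `Emin` on the total length:
the number of `w ∈ F_n` admitting data `s, t, λ, κ` (arc `[s, s+Σλ)`, occurrences `[t_i, t_i+λ_i)`,
flanks `κ_e`, all windows in `[0,n)`, `λ_i, κ_e ≤ ℓmax`, `Σλ + Σκ ≥ Emin`) satisfying the `D`- and
`F`-constraints with a `g`-regular arc is at most
`2k(2k−1)^{n−1} (2k−1)^{−Emin} (ℓmax+1)^{2d+3} Σ_S X^{|S|} (n+1)^{d+2−|S|} ((d+2)(d+3)(ℓmax+1))^{|S|}`,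
`X = (2k−1)^{(2ℓmax+g)/2}`. [cite: CalegariWalker2013, Lemma 4.14] -/
theorem card_filter_exists_combConfig_le {k n d ℓmax g Emin : ℕ} (hk : 1 ≤ k) (hn : 1 ≤ n)
    (hg : 1 ≤ g) :
    ((((reducedWords k n).filter fun w => ∃ (s : ℕ) (t lam kap : ℕ → ℕ) (vg : ℕ → Fin k × Bool),
        (∀ i (hi : i < n), vg i = w ⟨i, hi⟩) ∧
        ((∀ i, i < d + 1 → lam i ≤ ℓmax) ∧ (∀ e, e < d + 2 → kap e ≤ ℓmax) ∧ kap 0 = 0 ∧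
          kap (d + 1) = 0 ∧ s + ∑ i ∈ Finset.range (d + 1), lam i ≤ n ∧
          (∀ i, i < d + 1 → kap (i + 1) ≤ t i ∧ t i + lam i + kap i ≤ n) ∧
          Emin ≤ (∑ i ∈ Finset.range (d + 1), lam i) + ∑ e ∈ Finset.range (d + 2), kap e) ∧
        (∀ i, i < d + 1 → ∀ j, j < lam i →
          vg (t i + j) = ((vg (s + (∑ i' ∈ Finset.range i, lam i') + (lam i - 1 - j))).1,
            !(vg (s + (∑ i' ∈ Finset.range i, lam i') + (lam i - 1 - j))).2)) ∧
        (∀ e, 1 ≤ e → e ≤ d → ∀ j, j < kap e →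
          vg (t e + lam e + j) = ((vg (t (e - 1) - 1 - j)).1, !(vg (t (e - 1) - 1 - j)).2)) ∧
        (∀ x y, x ≠ y → x + g ≤ ∑ i' ∈ Finset.range (d + 1), lam i' →
          y + g ≤ ∑ i' ∈ Finset.range (d + 1), lam i' →
            ∃ q, q < g ∧ vg (s + x + q) ≠ vg (s + y + q)) ∧
        (∀ x y, x + g ≤ ∑ i' ∈ Finset.range (d + 1), lam i' →
          y + g ≤ ∑ i' ∈ Finset.range (d + 1), lam i' →
            ∃ q, q < g ∧ vg (s + x + q) ≠
              ((vg (s + y + (g - 1 - q))).1, !(vg (s + y + (g - 1 - q))).2))).card : ℕ) : ℝ) ≤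
      2 * k * (2 * k - 1 : ℝ) ^ (n - 1) * (2 * k - 1 : ℝ) ^ (-(Emin : ℝ)) *
        ((ℓmax + 1 : ℝ) ^ (d + 1) * (ℓmax + 1 : ℝ) ^ (d + 2)) *
        ∑ S : Finset (Fin (d + 2)), ((2 * k - 1 : ℝ) ^ (((2 * ℓmax + g : ℕ) : ℝ) / 2)) ^ S.card *
          ((n + 1 : ℝ) ^ (d + 2 - S.card) *
            (((d + 2) * ((d + 3) * (ℓmax + 1)) : ℕ) : ℝ) ^ S.card) := by
  set A := Fin k × Bool with hA
  let INV : Fin k × Bool → Fin k × Bool := fun a => (a.1, !a.2)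
  set q : ℝ := 2 * k - 1 with hq
  have hq1 : (1 : ℝ) ≤ q := by
    rw [hq]; have : (1 : ℝ) ≤ k := by exact_mod_cast hk
    linarith
  have hqpos : 0 < q := by linarith
  set X : ℝ := q ^ (((2 * ℓmax + g : ℕ) : ℝ) / 2) with hX
  have hX0 : 0 ≤ X := by positivity
  set Lblk := (d + 3) * (ℓmax + 1) with hLblk
  -- the comb predicate for `ℕ`-data
  set PRED : ℕ → (ℕ → ℕ) → (ℕ → ℕ) → (ℕ → ℕ) → (ℕ → A) → Prop := fun s t lam kap vg =>
      ((∀ i, i < d + 1 → lam i ≤ ℓmax) ∧ (∀ e, e < d + 2 → kap e ≤ ℓmax) ∧ kap 0 = 0 ∧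
          kap (d + 1) = 0 ∧ s + ∑ i ∈ Finset.range (d + 1), lam i ≤ n ∧
          (∀ i, i < d + 1 → kap (i + 1) ≤ t i ∧ t i + lam i + kap i ≤ n) ∧
          Emin ≤ (∑ i ∈ Finset.range (d + 1), lam i) + ∑ e ∈ Finset.range (d + 2), kap e) ∧
      (∀ i, i < d + 1 → ∀ j, j < lam i →
        vg (t i + j) = INV (vg (s + (∑ i' ∈ Finset.range i, lam i') + (lam i - 1 - j)))) ∧
      (∀ e, 1 ≤ e → e ≤ d → ∀ j, j < kap e →
        vg (t e + lam e + j) = INV (vg (t (e - 1) - 1 - j))) ∧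
      (∀ x y, x ≠ y → x + g ≤ ∑ i' ∈ Finset.range (d + 1), lam i' →
        y + g ≤ ∑ i' ∈ Finset.range (d + 1), lam i' →
          ∃ q, q < g ∧ vg (s + x + q) ≠ vg (s + y + q)) ∧
      (∀ x y, x + g ≤ ∑ i' ∈ Finset.range (d + 1), lam i' →
        y + g ≤ ∑ i' ∈ Finset.range (d + 1), lam i' →
          ∃ q, q < g ∧ vg (s + x + q) ≠ INV (vg (s + y + (g - 1 - q)))) with hPRED
  -- the finite configuration type and the extensions of its data
  set TT := Fin (d + 1) → Fin (n + 1) with hTT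
  set LL := Fin (d + 1) → Fin (ℓmax + 1) with hLL
  set KK := Fin (d + 2) → Fin (ℓmax + 1) with hKK
  set Cfg := Fin (n + 1) × TT × LL × KK with hCfg
  let tN : TT → ℕ → ℕ := fun t' i => if h : i < d + 1 then ((t' ⟨i, h⟩ : Fin (n + 1)) : ℕ) else 0
  let lamN : LL → ℕ → ℕ := fun lam' i =>
    if h : i < d + 1 then ((lam' ⟨i, h⟩ : Fin (ℓmax + 1)) : ℕ) else 0
  let kapN : KK → ℕ → ℕ := fun kap' e =>
    if h : e < d + 2 then ((kap' ⟨e, h⟩ : Fin (ℓmax + 1)) : ℕ) else 0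
  -- validity of the extended data
  let VALID : Fin (n + 1) → TT → LL → KK → Prop := fun s' t' lam' kap' =>
    (∀ i, i < d + 1 → lamN lam' i ≤ ℓmax) ∧ (∀ e, e < d + 2 → kapN kap' e ≤ ℓmax) ∧
      kapN kap' 0 = 0 ∧ kapN kap' (d + 1) = 0 ∧
      (s' : ℕ) + ∑ i ∈ Finset.range (d + 1), lamN lam' i ≤ n ∧
      (∀ i, i < d + 1 → kapN kap' (i + 1) ≤ tN t' i ∧ tN t' i + lamN lam' i + kapN kap' i ≤ n) ∧
      Emin ≤ (∑ i ∈ Finset.range (d + 1), lamN lam' i) + ∑ e ∈ Finset.range (d + 2), kapN kap' e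
  -- the pinned count of a configuration
  let pinC : Fin (n + 1) → TT → LL → KK → ℕ := fun s' t' lam' kap' =>
    (Finset.univ.filter fun u : Fin (d + 2) => ∃ u' : Fin (d + 2), u' ≠ u ∧
        (Finset.Ico (if (u : ℕ) = 0 then (s' : ℕ) else tN t' (u - 1) - kapN kap' u)
            (if (u : ℕ) = 0 then (s' : ℕ) + ∑ i ∈ Finset.range (d + 1), lamN lam' i
              else tN t' (u - 1) + lamN lam' (u - 1) + kapN kap' (u - 1)) ∩
          Finset.Ico (if (u' : ℕ) = 0 then (s' : ℕ) else tN t' (u' - 1) - kapN kap' u')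
            (if (u' : ℕ) = 0 then (s' : ℕ) + ∑ i ∈ Finset.range (d + 1), lamN lam' i
              else tN t' (u' - 1) + lamN lam' (u' - 1) + kapN kap' (u' - 1))).Nonempty ∧
        ((if (u' : ℕ) = 0 then (s' : ℕ) else tN t' (u' - 1) - kapN kap' u') <
            (if (u : ℕ) = 0 then (s' : ℕ) else tN t' (u - 1) - kapN kap' u) ∨
          ((if (u' : ℕ) = 0 then (s' : ℕ) else tN t' (u' - 1) - kapN kap' u') =
              (if (u : ℕ) = 0 then (s' : ℕ) else tN t' (u - 1) - kapN kap' u) ∧ u' < u))).card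
  set T := (reducedWords k n).filter fun w => ∃ (s : ℕ) (t lam kap : ℕ → ℕ) (vg : ℕ → A),
      (∀ i (hi : i < n), vg i = w ⟨i, hi⟩) ∧ PRED s t lam kap vg with hT
  set Tc : Cfg → Finset (Fin n → A) := fun c => (reducedWords k n).filter fun w =>
      ∃ vg : ℕ → A, (∀ i (hi : i < n), vg i = w ⟨i, hi⟩) ∧
        PRED (c.1 : ℕ) (tN c.2.1) (lamN c.2.2.1) (kapN c.2.2.2) vg with hTc
  show ((T.card : ℕ) : ℝ) ≤ _
  -- ### Step 1: `T ⊆ ⋃_c Tc c`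
  have hsub : T ⊆ Finset.univ.biUnion Tc := by
    intro w hw
    rw [hT, Finset.mem_filter] at hw
    obtain ⟨hwr, s, t, lam, kap, vg, hvg, hP⟩ := hw
    have hP' := hP
    obtain ⟨⟨hlam, hkap, hk0, hkl, hs, ht, hE⟩, _, _, _, _⟩ := hP'
    -- the configuration
    let c : Cfg := (⟨s, by omega⟩, fun i => ⟨t i, by have := (ht i i.2).2; omega⟩,
      fun i => ⟨lam i, by have := hlam i i.2; omega⟩,
      fun e => ⟨kap e, by have := hkap e e.2; omega⟩)
    rw [Finset.mem_biUnion]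
    refine ⟨c, Finset.mem_univ _, ?_⟩
    rw [hTc, Finset.mem_filter]
    refine ⟨hwr, vg, hvg, ?_⟩
    have het : ∀ i, i < d + 1 → tN c.2.1 i = t i := by
      intro i hi
      show (if h : i < d + 1 then ((c.2.1 ⟨i, h⟩ : Fin (n + 1)) : ℕ) else 0) = t i
      rw [dif_pos hi]
    have hel : ∀ i, i < d + 1 → lamN c.2.2.1 i = lam i := by
      intro i hi
      show (if h : i < d + 1 then ((c.2.2.1 ⟨i, h⟩ : Fin (ℓmax + 1)) : ℕ) else 0) = lam i
      rw [dif_pos hi]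
    have hek : ∀ e, e < d + 2 → kapN c.2.2.2 e = kap e := by
      intro e he
      show (if h : e < d + 2 then ((c.2.2.2 ⟨e, h⟩ : Fin (ℓmax + 1)) : ℕ) else 0) = kap e
      rw [dif_pos he]
    exact combPred_congr INV s t lam kap (tN c.2.1) (lamN c.2.2.1) (kapN c.2.2.2) vg het hel hek hP
  -- ### Step 2: the per-configuration bound
  set C₀ : ℝ := 2 * k * q ^ (n - 1) * q ^ (-(Emin : ℝ)) with hC₀
  have hC₀nn : 0 ≤ C₀ := by positivity
  have hper : ∀ (s' : Fin (n + 1)) (t' : TT) (lam' : LL) (kap' : KK),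
      ((Tc (s', t', lam', kap')).card : ℝ) ≤
        C₀ * (if VALID s' t' lam' kap' then X ^ pinC s' t' lam' kap' else 0) := by
    intro s' t' lam' kap'
    by_cases hval : VALID s' t' lam' kap'
    · rw [if_pos hval]
      obtain ⟨hlam, hkap, hk0, hkl, hs, ht, hE⟩ := hval
      have heq : Tc (s', t', lam', kap') = (reducedWords k n).filter fun w => ∃ vg : ℕ → A,
          (∀ i (hi : i < n), vg i = w ⟨i, hi⟩) ∧
          (∀ i, i < d + 1 → ∀ j, j < lamN lam' i →
            vg (tN t' i + j) = INV (vg ((s' : ℕ) + (∑ i' ∈ Finset.range i, lamN lam' i') +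
              (lamN lam' i - 1 - j)))) ∧
          (∀ e, 1 ≤ e → e ≤ d → ∀ j, j < kapN kap' e →
            vg (tN t' e + lamN lam' e + j) = INV (vg (tN t' (e - 1) - 1 - j))) ∧
          (∀ x y, x ≠ y → x + g ≤ ∑ i' ∈ Finset.range (d + 1), lamN lam' i' →
            y + g ≤ ∑ i' ∈ Finset.range (d + 1), lamN lam' i' →
              ∃ q, q < g ∧ vg ((s' : ℕ) + x + q) ≠ vg ((s' : ℕ) + y + q)) ∧
          (∀ x y, x + g ≤ ∑ i' ∈ Finset.range (d + 1), lamN lam' i' →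
            y + g ≤ ∑ i' ∈ Finset.range (d + 1), lamN lam' i' →
              ∃ q, q < g ∧ vg ((s' : ℕ) + x + q) ≠
                INV (vg ((s' : ℕ) + y + (g - 1 - q)))) := by
        rw [hTc]
        apply Finset.filter_congr
        intro w _
        constructor
        · rintro ⟨vg, hvg, _, hD, hF, hr1, hr2⟩; exact ⟨vg, hvg, hD, hF, hr1, hr2⟩
        · rintro ⟨vg, hvg, hD, hF, hr1, hr2⟩
          exact ⟨vg, hvg, ⟨hlam, hkap, hk0, hkl, hs, ht, hE⟩, hD, hF, hr1, hr2⟩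
      rw [heq]
      have hb := card_filter_combConfig_le (d := d) (ℓmax := ℓmax) hk hn hg (s' : ℕ) (tN t')
        (lamN lam') (kapN kap') hkap hk0 hkl hs ht
      refine hb.trans ?_
      show 2 * (k : ℝ) * (2 * k - 1) ^ (n - 1) *
          (2 * k - 1 : ℝ) ^ (-(((∑ i ∈ Finset.range (d + 1), lamN lam' i) +
            ∑ e ∈ Finset.range (d + 2), kapN kap' e : ℕ) : ℝ)) *
          X ^ pinC s' t' lam' kap' ≤ C₀ * X ^ pinC s' t' lam' kap'
      apply mul_le_mul_of_nonneg_right _ (by positivity)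
      rw [hC₀]
      apply mul_le_mul_of_nonneg_left _ (by positivity)
      apply Real.rpow_le_rpow_of_exponent_le hq1
      have : (Emin : ℝ) ≤ (((∑ i ∈ Finset.range (d + 1), lamN lam' i) +
          ∑ e ∈ Finset.range (d + 2), kapN kap' e : ℕ) : ℝ) := by exact_mod_cast hE
      linarith
    · rw [if_neg hval, mul_zero]
      have hempty : Tc (s', t', lam', kap') = ∅ := by
        rw [hTc, Finset.eq_empty_iff_forall_notMem]
        intro w hw
        rw [Finset.mem_filter] at hw
        obtain ⟨_, vg, _, hV, _⟩ := hw
        exact hval hV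
      rw [hempty, Finset.card_empty, Nat.cast_zero]
  -- ### Step 3: the inner sum over placements, for fixed lengths
  have hinner : ∀ (lam' : LL) (kap' : KK),
      ∑ p : Fin (n + 1) × TT,
        (if VALID p.1 p.2 lam' kap' then X ^ pinC p.1 p.2 lam' kap' else 0) ≤
      ∑ S : Finset (Fin (d + 2)), X ^ S.card * ((n + 1 : ℝ) ^ (d + 2 - S.card) *
        (((d + 2) * Lblk : ℕ) : ℝ) ^ S.card) := by
    intro lam' kap'
    -- block lengths
    let len : Fin (d + 2) → ℕ := fun u => if (u : ℕ) = 0 then ∑ i ∈ Finset.range (d + 1), lamN lam' i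
      else lamN lam' (u - 1) + kapN kap' (u - 1) + kapN kap' u
    have hlamN : ∀ i, lamN lam' i ≤ ℓmax := by
      intro i; simp only [lamN]; split_ifs with h
      · have := (lam' ⟨i, h⟩).2; omega
      · omega
    have hkapN : ∀ e, kapN kap' e ≤ ℓmax := by
      intro e; simp only [kapN]; split_ifs with h
      · have := (kap' ⟨e, h⟩).2; omega
      · omega
    have hlen : ∀ u, len u < Lblk := by
      intro u
      have hL : ∑ i ∈ Finset.range (d + 1), lamN lam' i ≤ (d + 1) * ℓmax := by
        calc ∑ i ∈ Finset.range (d + 1), lamN lam' i ≤ ∑ i ∈ Finset.range (d + 1), ℓmax :=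
              Finset.sum_le_sum fun i _ => hlamN i
          _ = (d + 1) * ℓmax := by simp
      have h1 : Lblk = (d + 3) * (ℓmax + 1) := rfl
      have h2 : (d + 1) * ℓmax < Lblk := by rw [h1]; nlinarith
      have h3 : 3 * ℓmax < Lblk := by rw [h1]; nlinarith
      simp only [len]
      split_ifs
      · omega
      · have := hlamN ((u : ℕ) - 1); have := hkapN ((u : ℕ) - 1); have := hkapN (u : ℕ); omega
    -- the placement map
    let L : Fin (n + 1) × TT → (Fin (d + 2) → Fin (n + 1)) := fun p u =>
      if h : (u : ℕ) = 0 then p.1 else ⟨(p.2 ⟨(u : ℕ) - 1, by omega⟩ : ℕ) - kapN kap' u, by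
        have := (p.2 ⟨(u : ℕ) - 1, by omega⟩).2; omega⟩
    have hLval : ∀ (p : Fin (n + 1) × TT) (u : Fin (d + 2)),
        ((L p u : Fin (n + 1)) : ℕ) = if (u : ℕ) = 0 then (p.1 : ℕ) else tN p.2 (u - 1) - kapN kap' u := by
      intro p u
      by_cases hu : (u : ℕ) = 0
      · simp only [L, dif_pos hu, if_pos hu]
      · have hlt : (u : ℕ) - 1 < d + 1 := by omega
        simp only [L, dif_neg hu, if_neg hu, tN, dif_pos hlt, Fin.val_mk]
    -- the set of valid placements
    set V := (Finset.univ : Finset (Fin (n + 1) × TT)).filter fun p => VALID p.1 p.2 lam' kap'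
      with hV
    -- on valid placements the pinned count is the pinned set of `L p`
    have hpinEq : ∀ p ∈ V, pinC p.1 p.2 lam' kap' =
        (Finset.univ.filter fun u : Fin (d + 2) => ∃ u' : Fin (d + 2), u' ≠ u ∧
          (Finset.Ico ((L p u : Fin (n + 1)) : ℕ) ((L p u : ℕ) + len u) ∩
            Finset.Ico ((L p u' : Fin (n + 1)) : ℕ) ((L p u' : ℕ) + len u')).Nonempty ∧
          (((L p u' : Fin (n + 1)) : ℕ) < (L p u : ℕ) ∨
            (((L p u' : Fin (n + 1)) : ℕ) = (L p u : ℕ) ∧ u' < u))).card := by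
      intro p hp
      rw [hV, Finset.mem_filter] at hp
      obtain ⟨_, _, _, _, _, _, ht, _⟩ := hp
      have hr : ∀ u : Fin (d + 2), ((L p u : Fin (n + 1)) : ℕ) + len u =
          if (u : ℕ) = 0 then (p.1 : ℕ) + ∑ i ∈ Finset.range (d + 1), lamN lam' i
            else tN p.2 (u - 1) + lamN lam' (u - 1) + kapN kap' (u - 1) := by
        intro u
        rw [hLval]
        by_cases hu : (u : ℕ) = 0
        · rw [if_pos hu, if_pos hu]
          show (p.1 : ℕ) + (if (u : ℕ) = 0 then ∑ i ∈ Finset.range (d + 1), lamN lam' i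
            else lamN lam' (u - 1) + kapN kap' (u - 1) + kapN kap' u) = _
          rw [if_pos hu]
        · simp only [len, hu, if_false]
          have h1 := (ht ((u : ℕ) - 1) (by omega)).1
          rw [show (u : ℕ) - 1 + 1 = (u : ℕ) by omega] at h1
          omega
      simp only [pinC]
      congr 1
      ext u
      simp only [hr]
      simp only [hLval]
    -- injectivity of `L` on valid placements
    have hinj : Set.InjOn L (V : Set (Fin (n + 1) × TT)) := by
      intro p hp p' hp' heq
      rw [Finset.mem_coe, hV, Finset.mem_filter] at hp hp'
      obtain ⟨_, _, _, _, _, _, ht, _⟩ := hp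
      obtain ⟨_, _, _, _, _, _, ht', _⟩ := hp'
      have h0 := congr_fun heq ⟨0, by omega⟩
      simp only [L] at h0
      simp at h0
      apply Prod.ext h0
      funext i
      have hi := congr_fun heq ⟨(i : ℕ) + 1, by omega⟩
      have hval := congrArg Fin.val hi
      rw [hLval, hLval] at hval
      simp only [Nat.add_one_ne_zero, if_false, Nat.add_sub_cancel] at hval
      have h1 := (ht i i.2).1
      have h2 := (ht' i i.2).1
      have e1 : tN p.2 i = (p.2 i : ℕ) := by
        show (if h : (i : ℕ) < d + 1 then ((p.2 ⟨i, h⟩ : Fin (n + 1)) : ℕ) else 0) = _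
        rw [dif_pos i.2]
      have e2 : tN p'.2 i = (p'.2 i : ℕ) := by
        show (if h : (i : ℕ) < d + 1 then ((p'.2 ⟨i, h⟩ : Fin (n + 1)) : ℕ) else 0) = _
        rw [dif_pos i.2]
      rw [e1] at hval h1
      rw [e2] at hval h2
      apply Fin.ext
      omega
    -- assemble
    rw [← Finset.sum_filter]
    calc ∑ p ∈ V, X ^ pinC p.1 p.2 lam' kap'
        = ∑ p ∈ V, X ^ (Finset.univ.filter fun u : Fin (d + 2) => ∃ u' : Fin (d + 2), u' ≠ u ∧
          (Finset.Ico ((L p u : Fin (n + 1)) : ℕ) ((L p u : ℕ) + len u) ∩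
            Finset.Ico ((L p u' : Fin (n + 1)) : ℕ) ((L p u' : ℕ) + len u')).Nonempty ∧
          (((L p u' : Fin (n + 1)) : ℕ) < (L p u : ℕ) ∨
            (((L p u' : Fin (n + 1)) : ℕ) = (L p u : ℕ) ∧ u' < u))).card := by
          apply Finset.sum_congr rfl
          intro p hp
          rw [hpinEq p hp]
      _ = ∑ l ∈ V.image L, X ^ (Finset.univ.filter fun u : Fin (d + 2) => ∃ u' : Fin (d + 2), u' ≠ u ∧
          (Finset.Ico ((l u : Fin (n + 1)) : ℕ) ((l u : ℕ) + len u) ∩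
            Finset.Ico ((l u' : Fin (n + 1)) : ℕ) ((l u' : ℕ) + len u')).Nonempty ∧
          (((l u' : Fin (n + 1)) : ℕ) < (l u : ℕ) ∨
            (((l u' : Fin (n + 1)) : ℕ) = (l u : ℕ) ∧ u' < u))).card := by
          rw [Finset.sum_image hinj]
      _ ≤ ∑ l : Fin (d + 2) → Fin (n + 1), X ^ (Finset.univ.filter fun u : Fin (d + 2) =>
          ∃ u' : Fin (d + 2), u' ≠ u ∧
          (Finset.Ico ((l u : Fin (n + 1)) : ℕ) ((l u : ℕ) + len u) ∩
            Finset.Ico ((l u' : Fin (n + 1)) : ℕ) ((l u' : ℕ) + len u')).Nonempty ∧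
          (((l u' : Fin (n + 1)) : ℕ) < (l u : ℕ) ∨
            (((l u' : Fin (n + 1)) : ℕ) = (l u : ℕ) ∧ u' < u))).card :=
          Finset.sum_le_sum_of_subset_of_nonneg (Finset.subset_univ _) (fun _ _ _ => by positivity)
      _ ≤ _ := sum_pow_card_pinned_le len hlen hX0
  -- ### Step 4: assemble
  have hcardT : ((T.card : ℕ) : ℝ) ≤ ∑ c : Cfg, ((Tc c).card : ℝ) := by
    have h1 : T.card ≤ (Finset.univ.biUnion Tc).card := Finset.card_le_card hsub
    have h2 : (Finset.univ.biUnion Tc).card ≤ ∑ c, (Tc c).card := Finset.card_biUnion_le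
    exact_mod_cast h1.trans h2
  refine hcardT.trans ?_
  have hstep1 : ∑ c : Cfg, ((Tc c).card : ℝ) ≤
      ∑ c : Cfg, C₀ * (if VALID c.1 c.2.1 c.2.2.1 c.2.2.2 then
        X ^ pinC c.1 c.2.1 c.2.2.1 c.2.2.2 else 0) := by
    apply Finset.sum_le_sum
    rintro ⟨s', t', lam', kap'⟩ _
    exact hper s' t' lam' kap'
  refine hstep1.trans ?_
  rw [← Finset.mul_sum]
  -- regroup the sum over configurations by lengths
  let e : Cfg ≃ (LL × KK) × (Fin (n + 1) × TT) :=
    (Equiv.prodAssoc (Fin (n + 1)) TT (LL × KK)).symm.trans (Equiv.prodComm _ _)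
  have hre : ∑ c : Cfg, (if VALID c.1 c.2.1 c.2.2.1 c.2.2.2 then
        X ^ pinC c.1 c.2.1 c.2.2.1 c.2.2.2 else 0) =
      ∑ p : (LL × KK) × (Fin (n + 1) × TT), (if VALID p.2.1 p.2.2 p.1.1 p.1.2 then
        X ^ pinC p.2.1 p.2.2 p.1.1 p.1.2 else 0) := by
    apply Fintype.sum_equiv e
    rintro ⟨s', t', lam', kap'⟩
    rfl
  rw [hre, Fintype.sum_prod_type]
  have hstep2 : ∑ lk : LL × KK, ∑ p : Fin (n + 1) × TT,
      (if VALID p.1 p.2 lk.1 lk.2 then X ^ pinC p.1 p.2 lk.1 lk.2 else 0) ≤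
      ∑ lk : LL × KK, ∑ S : Finset (Fin (d + 2)), X ^ S.card * ((n + 1 : ℝ) ^ (d + 2 - S.card) *
        (((d + 2) * Lblk : ℕ) : ℝ) ^ S.card) := by
    apply Finset.sum_le_sum
    rintro ⟨lam', kap'⟩ _
    exact hinner lam' kap'
  refine (mul_le_mul_of_nonneg_left hstep2 hC₀nn).trans ?_
  rw [Finset.sum_const, nsmul_eq_mul, Finset.card_univ, Fintype.card_prod, Fintype.card_fun,
    Fintype.card_fun, Fintype.card_fin, Fintype.card_fin, Fintype.card_fin]
  rw [hC₀, hX, hq, hLblk]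
  push_cast
  refine le_of_eq ?_
  ring

end CombCountSum

end Literature.GroupTheory.CombinatorialGroupTheory

end
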